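import Mathlib
import HarnessLib
import Summits.KontsevichZagierPeriods.Zeta5Search.VWPBarnesKernel

/-!
# ζ(5) search — the Barnes kernel of `F_m` off the base line: bounds uniform in `Re s`, pole-free lines, holomorphy (cell `pub-zeta5`, ct-1 g28)

HONEST FRAMING: systematic search; no irrationality claim unless kernel-certified.  Estimates for a special function (Stirling on
vertical lines, uniform for the real part in a compact interval); nothing here is an irrationality result, a worthiness exponent or
a denominator statement; no named fact is discharged; no definition is introduced.

Second piece of brick B4 of `HOME/ct-1/g27/VWP-BLUEPRINT-g27.md` (the Barnes-integral representation of Zudilin's very-well-poised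
series `F_m`, math/0206177 (1); Nesterenko 2003, Lemma 3).  The kernel

  `V(s) = (h₀ + 2s) · ∏_{j=0}^{m} Γ(h_j + s) · Γ(−s) / ∏_{j=1}^{m} Γ(1 + h₀ − h_j + s)`

was bounded on the base line `Re s = −s₁` in `VWPBarnesKernel`.  To shift the contour we need the same bound on horizontal segments
and on the far lines `Re s = N + ½`:

* `norm_Gamma_shift_le_uniform`, `norm_Gamma_shift_inv_le_uniform`, `norm_Gamma_neg_le_uniform`, and their Finset products — two-sided
  Stirling for `Γ(c + s)`, `Γ(−s)` with `Re s` in a compact interval `[a, b]` (from the Literature's `GammaStirlingVertical`);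
* **`norm_vwpKernel_le_uniform`** — `‖V(s)‖ ≤ C |Im s|^{E} e^{−π|Im s|}` for `Re s ∈ [a, b]`, `|Im s| ≥ R`, with Zudilin's exponent
  `E = 2 Σ_{j=1}^m Re h_j − (m−1) Re h₀ − m` (independent of `Re s`);
* `continuous_vwpKernel_line`, `integrable_vwpKernel_line`, **`integrable_norm_vwpKernel_line_mul_exp_pi`** — the kernel on ANY
  pole-free vertical line `Re s = x` (`x ∉ ℕ`, `x > −Re h_j`, `x > −Re(1+h₀−h_{j+1})`), the last one under (5);
* `differentiableAt_vwpKernel` — holomorphy of `V` off the poles of `Γ(h_j + s)` and `Γ(−s)`.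

Theorems only; imports `Zeta5Search/VWPBarnesKernel`.
-/

noncomputable section

namespace Summit.KontsevichZagierPeriods.Zeta5Search.VWPBarnesKernelUniform

open MeasureTheory Set Filter
open scoped Real
open Literature.Analysis.SpecialFunctions.GammaStirling (exists_norm_Gamma_vertical_le exists_norm_Gamma_vertical_ge)
open Summit.KontsevichZagierPeriods.Zeta5Search.BarnesKernelBounds (abs_add_rpow_le)
open Summit.KontsevichZagierPeriods.Zeta5Search.BarnesMellin (ne_neg_nat_of_re_pos)
open Summit.KontsevichZagierPeriods.Zeta5Search.VWPBarnesKernel (integrable_of_tail integrable_norm_mul_exp_pi_of_tail)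

/-! ### 1. Stirling pieces, uniform for `Re s` in a compact interval -/

/-- `c + s` as a point `x + u i` with real `x = Re c + Re s`, `u = Im c + Im s`. -/
theorem add_eq_mk (c s : ℂ) :
    c + s = ((c.re + s.re : ℝ) : ℂ) + ((c.im + s.im : ℝ) : ℂ) * Complex.I := by
  apply Complex.ext <;> simp

/-- `−s` as a point `x + u i` with real `x = −Re s`, `u = −Im s`. -/
theorem neg_eq_mk (s : ℂ) : -s = ((-s.re : ℝ) : ℂ) + ((-s.im : ℝ) : ℂ) * Complex.I := by
  apply Complex.ext <;> simp

/-- For `Re s ∈ [a, b]`: `|Re s| ≤ |a| + |b|`. -/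
theorem abs_re_le {a b : ℝ} {s : ℂ} (hs : s.re ∈ Icc a b) : |s.re| ≤ |a| + |b| := by
  rcases hs with ⟨h1, h2⟩
  rcases le_total 0 s.re with h0 | h0
  · rw [abs_of_nonneg h0]; linarith [le_abs_self b, abs_nonneg a]
  · rw [abs_of_nonpos h0]; linarith [neg_abs_le a, abs_nonneg b]

/-- **Upper Stirling bound for `Γ(c + s)`, uniform for `Re s ∈ [a, b]`**: there are `C > 0`, `R ≥ 1` with
`‖Γ(c + s)‖ ≤ C |Im s|^{Re c + Re s − ½} e^{−π|Im s|/2}` whenever `Re s ∈ [a, b]` and `|Im s| ≥ R`. -/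
theorem norm_Gamma_shift_le_uniform (c : ℂ) (a b : ℝ) :
    ∃ C : ℝ, 0 < C ∧ ∃ R : ℝ, 1 ≤ R ∧ ∀ s : ℂ, s.re ∈ Icc a b → R ≤ |s.im| →
      ‖Complex.Gamma (c + s)‖ ≤ C * |s.im| ^ (c.re + s.re - 1 / 2) * Real.exp (-(π * |s.im|) / 2) := by
  obtain ⟨C₁, hC₁, h₁⟩ := exists_norm_Gamma_vertical_le (c.re + a) (c.re + b)
  set Q : ℝ := |c.re| + (|a| + |b|) + 1 / 2 with hQ
  refine ⟨C₁ * (2 : ℝ) ^ Q * Real.exp (π * |c.im| / 2), by positivity, 2 * |c.im| + 2,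
    by linarith [abs_nonneg c.im], fun s hs hy => ?_⟩
  obtain ⟨hu1, hpow⟩ := abs_add_rpow_le c.im (c.re + s.re - 1 / 2) hy
  have hq : |c.re + s.re - 1 / 2| ≤ Q := by
    have h1 : |c.re + s.re - 1 / 2| ≤ |c.re + s.re| + |(1 / 2 : ℝ)| := abs_sub _ _
    have h2 : |c.re + s.re| ≤ |c.re| + |s.re| := abs_add_le _ _
    rw [abs_of_pos (by norm_num : (0 : ℝ) < 1 / 2)] at h1
    linarith [abs_re_le hs]
  have h2Q : (2 : ℝ) ^ |c.re + s.re - 1 / 2| ≤ (2 : ℝ) ^ Q :=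
    Real.rpow_le_rpow_of_exponent_le (by norm_num) hq
  have hlow : |s.im| - |c.im| ≤ |c.im + s.im| := by
    have h := abs_sub (c.im + s.im) c.im
    rw [add_sub_cancel_left] at h
    linarith
  have hΓ := h₁ (c.re + s.re) ⟨by linarith [hs.1], by linarith [hs.2]⟩ (c.im + s.im) hu1
  have hexp : Real.exp (-(π * |c.im + s.im|) / 2) ≤ Real.exp (π * |c.im| / 2) * Real.exp (-(π * |s.im|) / 2) := by
    rw [← Real.exp_add]
    apply Real.exp_le_exp.2
    have := mul_le_mul_of_nonneg_left hlow Real.pi_pos.le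
    linarith
  have hpow' : |c.im + s.im| ^ (c.re + s.re - 1 / 2) ≤ (2 : ℝ) ^ Q * |s.im| ^ (c.re + s.re - 1 / 2) :=
    hpow.trans (mul_le_mul_of_nonneg_right h2Q (Real.rpow_nonneg (abs_nonneg _) _))
  rw [add_eq_mk]
  calc ‖Complex.Gamma (((c.re + s.re : ℝ) : ℂ) + ((c.im + s.im : ℝ) : ℂ) * Complex.I)‖
      ≤ C₁ * |c.im + s.im| ^ (c.re + s.re - 1 / 2) * Real.exp (-(π * |c.im + s.im|) / 2) := hΓ
    _ ≤ C₁ * ((2 : ℝ) ^ Q * |s.im| ^ (c.re + s.re - 1 / 2)) *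
          (Real.exp (π * |c.im| / 2) * Real.exp (-(π * |s.im|) / 2)) := by gcongr
    _ = _ := by ring

/-- **Reciprocal lower Stirling bound for `Γ(c + s)`, uniform for `Re s ∈ [a, b]`**: there are `C > 0`, `R ≥ 1` with
`‖Γ(c + s)‖⁻¹ ≤ C |Im s|^{−(Re c + Re s − ½)} e^{π|Im s|/2}` whenever `Re s ∈ [a, b]` and `|Im s| ≥ R`. -/
theorem norm_Gamma_shift_inv_le_uniform (c : ℂ) (a b : ℝ) :
    ∃ C : ℝ, 0 < C ∧ ∃ R : ℝ, 1 ≤ R ∧ ∀ s : ℂ, s.re ∈ Icc a b → R ≤ |s.im| →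
      ‖Complex.Gamma (c + s)‖⁻¹ ≤ C * |s.im| ^ (-(c.re + s.re - 1 / 2)) * Real.exp (π * |s.im| / 2) := by
  obtain ⟨c₁, hc₁, h₁⟩ := exists_norm_Gamma_vertical_ge (c.re + a) (c.re + b)
  set Q : ℝ := |c.re| + (|a| + |b|) + 1 / 2 with hQ
  refine ⟨c₁⁻¹ * (2 : ℝ) ^ Q * Real.exp (π * |c.im| / 2), by positivity, 2 * |c.im| + 2,
    by linarith [abs_nonneg c.im], fun s hs hy => ?_⟩
  obtain ⟨hu1, hpow⟩ := abs_add_rpow_le c.im (-(c.re + s.re - 1 / 2)) hy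
  have hq : |-(c.re + s.re - 1 / 2)| ≤ Q := by
    rw [abs_neg]
    have h1 : |c.re + s.re - 1 / 2| ≤ |c.re + s.re| + |(1 / 2 : ℝ)| := abs_sub _ _
    have h2 : |c.re + s.re| ≤ |c.re| + |s.re| := abs_add_le _ _
    rw [abs_of_pos (by norm_num : (0 : ℝ) < 1 / 2)] at h1
    linarith [abs_re_le hs]
  have h2Q : (2 : ℝ) ^ |-(c.re + s.re - 1 / 2)| ≤ (2 : ℝ) ^ Q :=
    Real.rpow_le_rpow_of_exponent_le (by norm_num) hq
  have hup : |c.im + s.im| ≤ |c.im| + |s.im| := abs_add_le _ _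
  have hu0 : 0 < |c.im + s.im| := by linarith
  have hΓ := h₁ (c.re + s.re) ⟨by linarith [hs.1], by linarith [hs.2]⟩ (c.im + s.im) hu1
  have hpos : 0 < c₁ * |c.im + s.im| ^ (c.re + s.re - 1 / 2) * Real.exp (-(π * |c.im + s.im|) / 2) :=
    mul_pos (mul_pos hc₁ (Real.rpow_pos_of_pos hu0 _)) (Real.exp_pos _)
  have hinv := inv_anti₀ hpos hΓ
  have hrew : (c₁ * |c.im + s.im| ^ (c.re + s.re - 1 / 2) * Real.exp (-(π * |c.im + s.im|) / 2))⁻¹ =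
      c₁⁻¹ * |c.im + s.im| ^ (-(c.re + s.re - 1 / 2)) * Real.exp (π * |c.im + s.im| / 2) := by
    rw [mul_inv, mul_inv, Real.rpow_neg hu0.le, ← Real.exp_neg]
    congr 2
    ring
  have hexp : Real.exp (π * |c.im + s.im| / 2) ≤ Real.exp (π * |c.im| / 2) * Real.exp (π * |s.im| / 2) := by
    rw [← Real.exp_add]
    apply Real.exp_le_exp.2
    have := mul_le_mul_of_nonneg_left hup Real.pi_pos.le
    linarith
  have hpow' : |c.im + s.im| ^ (-(c.re + s.re - 1 / 2)) ≤ (2 : ℝ) ^ Q * |s.im| ^ (-(c.re + s.re - 1 / 2)) :=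
    hpow.trans (mul_le_mul_of_nonneg_right h2Q (Real.rpow_nonneg (abs_nonneg _) _))
  rw [add_eq_mk]
  calc ‖Complex.Gamma (((c.re + s.re : ℝ) : ℂ) + ((c.im + s.im : ℝ) : ℂ) * Complex.I)‖⁻¹
      ≤ (c₁ * |c.im + s.im| ^ (c.re + s.re - 1 / 2) * Real.exp (-(π * |c.im + s.im|) / 2))⁻¹ := hinv
    _ = c₁⁻¹ * |c.im + s.im| ^ (-(c.re + s.re - 1 / 2)) * Real.exp (π * |c.im + s.im| / 2) := hrew
    _ ≤ c₁⁻¹ * ((2 : ℝ) ^ Q * |s.im| ^ (-(c.re + s.re - 1 / 2))) *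
          (Real.exp (π * |c.im| / 2) * Real.exp (π * |s.im| / 2)) := by gcongr
    _ = _ := by ring

/-- **Stirling for `Γ(−s)`, uniform for `Re s ∈ [a, b]`**: `‖Γ(−s)‖ ≤ C |Im s|^{−Re s − ½} e^{−π|Im s|/2}` for `|Im s| ≥ 1`. -/
theorem norm_Gamma_neg_le_uniform (a b : ℝ) :
    ∃ C : ℝ, 0 < C ∧ ∀ s : ℂ, s.re ∈ Icc a b → 1 ≤ |s.im| →
      ‖Complex.Gamma (-s)‖ ≤ C * |s.im| ^ (-s.re - 1 / 2) * Real.exp (-(π * |s.im|) / 2) := by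
  obtain ⟨C, hC, h⟩ := exists_norm_Gamma_vertical_le (-b) (-a)
  refine ⟨C, hC, fun s hs hy => ?_⟩
  have := h (-s.re) ⟨by linarith [hs.2], by linarith [hs.1]⟩ (-s.im) (by simpa using hy)
  rw [neg_eq_mk]
  simpa [abs_neg] using this

/-- Finset product of the uniform upper bounds:
`∏_{j∈S} ‖Γ(c_j + s)‖ ≤ C |Im s|^{Σ_{j∈S}(Re c_j + Re s − ½)} e^{−(π|Im s|/2)·#S}` for `Re s ∈ [a, b]`, `|Im s| ≥ R`. -/
theorem norm_prod_Gamma_shift_le_uniform (S : Finset ℕ) (c : ℕ → ℂ) (a b : ℝ) :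
    ∃ C : ℝ, 0 < C ∧ ∃ R : ℝ, 1 ≤ R ∧ ∀ s : ℂ, s.re ∈ Icc a b → R ≤ |s.im| →
      ∏ j ∈ S, ‖Complex.Gamma (c j + s)‖ ≤
        C * |s.im| ^ (∑ j ∈ S, ((c j).re + s.re - 1 / 2)) * Real.exp (-(π * |s.im|) / 2 * (S.card : ℝ)) := by
  classical
  induction S using Finset.induction_on with
  | empty => exact ⟨1, one_pos, 1, le_rfl, fun s _ _ => by simp⟩
  | insert j S hj ih =>
    obtain ⟨C₁, hC₁, R₁, hR₁, h₁⟩ := ih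
    obtain ⟨C₂, hC₂, R₂, hR₂, h₂⟩ := norm_Gamma_shift_le_uniform (c j) a b
    refine ⟨C₂ * C₁, mul_pos hC₂ hC₁, max R₁ R₂, le_max_of_le_left hR₁, fun s hs hy => ?_⟩
    have hy₁ : R₁ ≤ |s.im| := le_trans (le_max_left _ _) hy
    have hy₂ : R₂ ≤ |s.im| := le_trans (le_max_right _ _) hy
    have hy0 : 0 < |s.im| := by linarith
    rw [Finset.prod_insert hj, Finset.sum_insert hj, Finset.card_insert_of_notMem hj]
    push_cast
    calc ‖Complex.Gamma (c j + s)‖ * ∏ i ∈ S, ‖Complex.Gamma (c i + s)‖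
        ≤ (C₂ * |s.im| ^ ((c j).re + s.re - 1 / 2) * Real.exp (-(π * |s.im|) / 2)) *
          (C₁ * |s.im| ^ (∑ i ∈ S, ((c i).re + s.re - 1 / 2)) * Real.exp (-(π * |s.im|) / 2 * (S.card : ℝ))) :=
          mul_le_mul (h₂ s hs hy₂) (h₁ s hs hy₁) (Finset.prod_nonneg fun _ _ => norm_nonneg _) (by positivity)
      _ = C₂ * C₁ * |s.im| ^ ((c j).re + s.re - 1 / 2 + ∑ i ∈ S, ((c i).re + s.re - 1 / 2)) *
          Real.exp (-(π * |s.im|) / 2 * ((S.card : ℝ) + 1)) := by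
          rw [Real.rpow_add hy0, show -(π * |s.im|) / 2 * ((S.card : ℝ) + 1) =
            -(π * |s.im|) / 2 + -(π * |s.im|) / 2 * (S.card : ℝ) by ring, Real.exp_add]
          ring

/-- Finset product of the uniform reciprocal bounds:
`∏_{j∈S} ‖Γ(c_j + s)‖⁻¹ ≤ C |Im s|^{−Σ_{j∈S}(Re c_j + Re s − ½)} e^{(π|Im s|/2)·#S}` for `Re s ∈ [a, b]`, `|Im s| ≥ R`. -/
theorem norm_prod_Gamma_shift_inv_le_uniform (S : Finset ℕ) (c : ℕ → ℂ) (a b : ℝ) :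
    ∃ C : ℝ, 0 < C ∧ ∃ R : ℝ, 1 ≤ R ∧ ∀ s : ℂ, s.re ∈ Icc a b → R ≤ |s.im| →
      ∏ j ∈ S, ‖Complex.Gamma (c j + s)‖⁻¹ ≤
        C * |s.im| ^ (-∑ j ∈ S, ((c j).re + s.re - 1 / 2)) * Real.exp (π * |s.im| / 2 * (S.card : ℝ)) := by
  classical
  induction S using Finset.induction_on with
  | empty => exact ⟨1, one_pos, 1, le_rfl, fun s _ _ => by simp⟩
  | insert j S hj ih =>
    obtain ⟨C₁, hC₁, R₁, hR₁, h₁⟩ := ih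
    obtain ⟨C₂, hC₂, R₂, hR₂, h₂⟩ := norm_Gamma_shift_inv_le_uniform (c j) a b
    refine ⟨C₂ * C₁, mul_pos hC₂ hC₁, max R₁ R₂, le_max_of_le_left hR₁, fun s hs hy => ?_⟩
    have hy₁ : R₁ ≤ |s.im| := le_trans (le_max_left _ _) hy
    have hy₂ : R₂ ≤ |s.im| := le_trans (le_max_right _ _) hy
    have hy0 : 0 < |s.im| := by linarith
    rw [Finset.prod_insert hj, Finset.sum_insert hj, Finset.card_insert_of_notMem hj]
    push_cast
    calc ‖Complex.Gamma (c j + s)‖⁻¹ * ∏ i ∈ S, ‖Complex.Gamma (c i + s)‖⁻¹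
        ≤ (C₂ * |s.im| ^ (-((c j).re + s.re - 1 / 2)) * Real.exp (π * |s.im| / 2)) *
          (C₁ * |s.im| ^ (-∑ i ∈ S, ((c i).re + s.re - 1 / 2)) * Real.exp (π * |s.im| / 2 * (S.card : ℝ))) :=
          mul_le_mul (h₂ s hs hy₂) (h₁ s hs hy₁) (Finset.prod_nonneg fun _ _ => inv_nonneg.2 (norm_nonneg _))
            (by positivity)
      _ = C₂ * C₁ * |s.im| ^ (-((c j).re + s.re - 1 / 2 + ∑ i ∈ S, ((c i).re + s.re - 1 / 2))) *
          Real.exp (π * |s.im| / 2 * ((S.card : ℝ) + 1)) := by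
          rw [neg_add, Real.rpow_add hy0, show π * |s.im| / 2 * ((S.card : ℝ) + 1) =
            π * |s.im| / 2 + π * |s.im| / 2 * (S.card : ℝ) by ring, Real.exp_add]
          ring

/-! ### 2. The kernel of `F_m`, uniformly for `Re s ∈ [a, b]` -/

/-- The linear factor: `‖h₀ + 2s‖ ≤ (‖h₀‖ + 2(|a|+|b|) + 2)|Im s|` for `Re s ∈ [a, b]`, `|Im s| ≥ 1`. -/
theorem norm_linear_le_uniform (h₀ : ℂ) {a b : ℝ} {s : ℂ} (hs : s.re ∈ Icc a b) (hy : 1 ≤ |s.im|) :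
    ‖h₀ + 2 * s‖ ≤ (‖h₀‖ + 2 * (|a| + |b|) + 2) * |s.im| ^ (1 : ℝ) := by
  rw [Real.rpow_one]
  have hs' : ‖s‖ ≤ |s.re| + |s.im| := Complex.norm_le_abs_re_add_abs_im s
  have hre := abs_re_le hs
  calc ‖h₀ + 2 * s‖ ≤ ‖h₀‖ + ‖(2 : ℂ) * s‖ := norm_add_le _ _
    _ = ‖h₀‖ + 2 * ‖s‖ := by rw [norm_mul, Complex.norm_two]
    _ ≤ ‖h₀‖ + 2 * ((|a| + |b|) + |s.im|) := by linarith
    _ ≤ (‖h₀‖ + 2 * (|a| + |b|) + 2) * |s.im| := by nlinarith [norm_nonneg h₀, abs_nonneg a, abs_nonneg b]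

/-- The raw exponent does not depend on `Re s` and equals Zudilin's `E = 2 Σ_{j=1}^m Re h_j − (m−1) Re h₀ − m`. -/
theorem exponent_eq_uniform (m : ℕ) (h : ℕ → ℂ) (x : ℝ) :
    1 + (∑ j ∈ Finset.range (m + 1), ((h j).re + x - 1 / 2)) + (-x - 1 / 2) +
        -(∑ j ∈ Finset.range m, ((1 + h 0 - h (j + 1)).re + x - 1 / 2)) =
      2 * (∑ j ∈ Finset.range m, (h (j + 1)).re) - ((m : ℝ) - 1) * (h 0).re - m := by
  rw [Finset.sum_range_succ']
  simp only [Finset.sum_add_distrib, Finset.sum_sub_distrib, Finset.sum_const, Finset.card_range, nsmul_eq_mul,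
    Complex.add_re, Complex.sub_re, Complex.one_re]
  ring

/-- **Decay of the `F_m` Barnes kernel, uniform for `Re s ∈ [a, b]`**: there are `C > 0`, `R ≥ 1` with
`‖(h₀+2s)∏_{j≤m}Γ(h_j+s)Γ(−s)/∏_{j<m}Γ(1+h₀−h_{j+1}+s)‖ ≤ C |Im s|^{E} e^{−π|Im s|}` for `Re s ∈ [a, b]`, `|Im s| ≥ R`, where
`E = 2 Σ_{j=1}^m Re h_j − (m−1) Re h₀ − m` (no hypothesis on the parameters). -/
theorem norm_vwpKernel_le_uniform (m : ℕ) (h : ℕ → ℂ) (a b : ℝ) :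
    ∃ C : ℝ, 0 < C ∧ ∃ R : ℝ, 1 ≤ R ∧ ∀ s : ℂ, s.re ∈ Icc a b → R ≤ |s.im| →
      ‖(h 0 + 2 * s) * (∏ j ∈ Finset.range (m + 1), Complex.Gamma (h j + s)) * Complex.Gamma (-s) /
          ∏ j ∈ Finset.range m, Complex.Gamma (1 + h 0 - h (j + 1) + s)‖ ≤
        C * |s.im| ^ (2 * (∑ j ∈ Finset.range m, (h (j + 1)).re) - ((m : ℝ) - 1) * (h 0).re - m) *
          Real.exp (-(π * |s.im|)) := by
  obtain ⟨C₁, hC₁, R₁, hR₁, h₁⟩ := norm_prod_Gamma_shift_le_uniform (Finset.range (m + 1)) h a b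
  obtain ⟨C₃, hC₃, h₃⟩ := norm_Gamma_neg_le_uniform a b
  obtain ⟨C₄, hC₄, R₄, hR₄, h₄⟩ := norm_prod_Gamma_shift_inv_le_uniform (Finset.range m) (fun j => 1 + h 0 - h (j + 1)) a b
  refine ⟨(‖h 0‖ + 2 * (|a| + |b|) + 2) * C₁ * C₃ * C₄, by positivity, max R₁ R₄, le_max_of_le_left hR₁, fun s hs hy => ?_⟩
  have hy₁ : R₁ ≤ |s.im| := le_trans (le_max_left _ _) hy
  have hy₄ : R₄ ≤ |s.im| := le_trans (le_max_right _ _) hy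
  have hy1 : 1 ≤ |s.im| := le_trans hR₁ hy₁
  have hy0 : 0 < |s.im| := by linarith
  have g0 := norm_linear_le_uniform (h 0) hs hy1
  have g1 := h₁ s hs hy₁
  have g3 := h₃ s hs hy1
  have g4 := h₄ s hs hy₄
  rw [Finset.card_range] at g1 g4
  rw [← exponent_eq_uniform m h s.re]
  rw [norm_div, norm_mul, norm_mul, norm_prod, norm_prod, div_eq_mul_inv, ← Finset.prod_inv_distrib]
  set E₁ : ℝ := ∑ j ∈ Finset.range (m + 1), ((h j).re + s.re - 1 / 2) with hE₁
  set E₄ : ℝ := ∑ j ∈ Finset.range m, ((1 + h 0 - h (j + 1)).re + s.re - 1 / 2) with hE₄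
  have hP : |s.im| ^ (1 : ℝ) * |s.im| ^ E₁ * |s.im| ^ (-s.re - 1 / 2) * |s.im| ^ (-E₄) =
      |s.im| ^ (1 + E₁ + (-s.re - 1 / 2) + -E₄) := by
    rw [← Real.rpow_add hy0, ← Real.rpow_add hy0, ← Real.rpow_add hy0]
  have hX : Real.exp (-(π * |s.im|) / 2 * ((m + 1 : ℕ) : ℝ)) * Real.exp (-(π * |s.im|) / 2) *
      Real.exp (π * |s.im| / 2 * (m : ℝ)) = Real.exp (-(π * |s.im|)) := by
    rw [← Real.exp_add, ← Real.exp_add]; push_cast; congr 1; ring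
  calc ‖h 0 + 2 * s‖ * (∏ j ∈ Finset.range (m + 1), ‖Complex.Gamma (h j + s)‖) * ‖Complex.Gamma (-s)‖ *
          ∏ j ∈ Finset.range m, ‖Complex.Gamma (1 + h 0 - h (j + 1) + s)‖⁻¹
      ≤ ((‖h 0‖ + 2 * (|a| + |b|) + 2) * |s.im| ^ (1 : ℝ)) *
          (C₁ * |s.im| ^ E₁ * Real.exp (-(π * |s.im|) / 2 * ((m + 1 : ℕ) : ℝ))) *
          (C₃ * |s.im| ^ (-s.re - 1 / 2) * Real.exp (-(π * |s.im|) / 2)) *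
          (C₄ * |s.im| ^ (-E₄) * Real.exp (π * |s.im| / 2 * (m : ℝ))) :=
        mul_le_mul (mul_le_mul (mul_le_mul g0 g1 (Finset.prod_nonneg fun _ _ => norm_nonneg _) (by positivity)) g3
          (norm_nonneg _) (by positivity)) g4 (Finset.prod_nonneg fun _ _ => inv_nonneg.2 (norm_nonneg _)) (by positivity)
    _ = (‖h 0‖ + 2 * (|a| + |b|) + 2) * C₁ * C₃ * C₄ *
          (|s.im| ^ (1 : ℝ) * |s.im| ^ E₁ * |s.im| ^ (-s.re - 1 / 2) * |s.im| ^ (-E₄)) *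
          (Real.exp (-(π * |s.im|) / 2 * ((m + 1 : ℕ) : ℝ)) * Real.exp (-(π * |s.im|) / 2) *
            Real.exp (π * |s.im| / 2 * (m : ℝ))) := by ring
    _ = _ := by rw [hP, hX]

/-! ### 3. The kernel on a pole-free vertical line `Re s = x` -/

/-- A point of the line `Re s = x` is never a natural number when `x ∉ ℕ`. -/
theorem line_ne_nat {x : ℝ} (hx : ∀ n : ℕ, x ≠ n) (y : ℝ) (n : ℕ) : (x : ℂ) + (y : ℂ) * Complex.I ≠ (n : ℂ) := by
  intro h
  have := congrArg Complex.re h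
  simp at this
  exact hx n this

/-- **Continuity of the kernel on a pole-free line** `Re s = x`: `x ∉ ℕ` (no pole of `Γ(−s)`), `x > −Re h_j` (`j ≤ m`) and
`x > −Re(1+h₀−h_{j+1})` (`j < m`). -/
theorem continuous_vwpKernel_line (m : ℕ) (h : ℕ → ℂ) {x : ℝ} (hx : ∀ n : ℕ, x ≠ n) (hnum : ∀ j, j ≤ m → -(h j).re < x)
    (hden : ∀ j, j < m → -(1 + h 0 - h (j + 1)).re < x) :
    Continuous fun y : ℝ =>
      (h 0 + 2 * ((x : ℂ) + (y : ℂ) * Complex.I)) *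
            (∏ j ∈ Finset.range (m + 1), Complex.Gamma (h j + ((x : ℂ) + (y : ℂ) * Complex.I))) *
            Complex.Gamma (-((x : ℂ) + (y : ℂ) * Complex.I)) /
          ∏ j ∈ Finset.range m, Complex.Gamma (1 + h 0 - h (j + 1) + ((x : ℂ) + (y : ℂ) * Complex.I)) := by
  have hΓ : ∀ (f : ℝ → ℂ), Continuous f → (∀ y, ∀ n : ℕ, f y ≠ -(n : ℂ)) → Continuous fun y => Complex.Gamma (f y) := by
    intro f hf hne
    exact continuous_iff_continuousAt.mpr fun y => (Complex.continuousAt_Gamma _ (hne y)).comp hf.continuousAt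
  refine Continuous.div ((Continuous.mul (by fun_prop) (continuous_finsetProd _ fun j hj => ?_)).mul ?_)
    (continuous_finsetProd _ fun j hj => ?_) fun y => ?_
  · refine hΓ _ (by fun_prop) fun y => ne_neg_nat_of_re_pos ?_
    have := hnum j (by simpa [Nat.lt_succ_iff] using hj); simp; linarith
  · refine hΓ _ (by fun_prop) fun y n hyn => ?_
    exact line_ne_nat hx y n (by simpa using congrArg Neg.neg hyn)
  · refine hΓ _ (by fun_prop) fun y => ne_neg_nat_of_re_pos ?_
    have := hden j (by simpa using hj); simp at this ⊢; linarith
  · exact Finset.prod_ne_zero_iff.2 fun j hj => Complex.Gamma_ne_zero_of_re_pos (by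
      have := hden j (by simpa using hj); simp at this ⊢; linarith)

/-- The kernel is integrable on every pole-free line `Re s = x` (decay `e^{−π|y|}`). -/
theorem integrable_vwpKernel_line (m : ℕ) (h : ℕ → ℂ) {x : ℝ} (hx : ∀ n : ℕ, x ≠ n) (hnum : ∀ j, j ≤ m → -(h j).re < x)
    (hden : ∀ j, j < m → -(1 + h 0 - h (j + 1)).re < x) :
    Integrable fun y : ℝ =>
      (h 0 + 2 * ((x : ℂ) + (y : ℂ) * Complex.I)) *
            (∏ j ∈ Finset.range (m + 1), Complex.Gamma (h j + ((x : ℂ) + (y : ℂ) * Complex.I))) *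
            Complex.Gamma (-((x : ℂ) + (y : ℂ) * Complex.I)) /
          ∏ j ∈ Finset.range m, Complex.Gamma (1 + h 0 - h (j + 1) + ((x : ℂ) + (y : ℂ) * Complex.I)) := by
  obtain ⟨C, -, R, hR, hb⟩ := norm_vwpKernel_le_uniform m h x x
  refine integrable_of_tail (continuous_vwpKernel_line m h hx hnum hden) (C := C)
    (E := 2 * (∑ j ∈ Finset.range m, (h (j + 1)).re) - ((m : ℝ) - 1) * (h 0).re - m) hR fun y hy => ?_
  have := hb ((x : ℂ) + (y : ℂ) * Complex.I) (by simp) (by simpa using hy)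
  simpa using this

/-- **With the phase weight, under (5)**: on every pole-free line `Re s = x`, `y ↦ ‖V(x+iy)‖ e^{π|y|}` is integrable when
`2 Σ_{j=1}^m Re h_j < (m−1)(1 + Re h₀)`. -/
theorem integrable_norm_vwpKernel_line_mul_exp_pi (m : ℕ) (h : ℕ → ℂ) {x : ℝ} (hx : ∀ n : ℕ, x ≠ n)
    (hnum : ∀ j, j ≤ m → -(h j).re < x) (hden : ∀ j, j < m → -(1 + h 0 - h (j + 1)).re < x)
    (h5 : 2 * (∑ j ∈ Finset.range m, (h (j + 1)).re) < ((m : ℝ) - 1) * (1 + (h 0).re)) :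
    Integrable fun y : ℝ =>
      ‖(h 0 + 2 * ((x : ℂ) + (y : ℂ) * Complex.I)) *
            (∏ j ∈ Finset.range (m + 1), Complex.Gamma (h j + ((x : ℂ) + (y : ℂ) * Complex.I))) *
            Complex.Gamma (-((x : ℂ) + (y : ℂ) * Complex.I)) /
          ∏ j ∈ Finset.range m, Complex.Gamma (1 + h 0 - h (j + 1) + ((x : ℂ) + (y : ℂ) * Complex.I))‖ *
        Real.exp (π * |y|) := by
  obtain ⟨C, -, R, hR, hb⟩ := norm_vwpKernel_le_uniform m h x x
  refine integrable_norm_mul_exp_pi_of_tail (continuous_vwpKernel_line m h hx hnum hden) (C := C)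
    (E := 2 * (∑ j ∈ Finset.range m, (h (j + 1)).re) - ((m : ℝ) - 1) * (h 0).re - m) hR (by linarith) fun y hy => ?_
  have := hb ((x : ℂ) + (y : ℂ) * Complex.I) (by simp) (by simpa using hy)
  simpa using this

/-! ### 4. Holomorphy of the kernel off the poles -/

/-- **The kernel is holomorphic** at every `z` with `Re(h_j + z) > 0` (`j ≤ m`) which is not a natural number (the only other
singularities, the zeros of the denominator, are harmless: `1/Γ` is entire). -/
theorem differentiableAt_vwpKernel (m : ℕ) (h : ℕ → ℂ) {z : ℂ} (hnum : ∀ j, j ≤ m → -(h j).re < z.re)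
    (hz : ∀ n : ℕ, z ≠ n) :
    DifferentiableAt ℂ (fun s : ℂ =>
      (h 0 + 2 * s) * (∏ j ∈ Finset.range (m + 1), Complex.Gamma (h j + s)) * Complex.Gamma (-s) /
          ∏ j ∈ Finset.range m, Complex.Gamma (1 + h 0 - h (j + 1) + s)) z := by
  have hrew : (fun s : ℂ =>
      (h 0 + 2 * s) * (∏ j ∈ Finset.range (m + 1), Complex.Gamma (h j + s)) * Complex.Gamma (-s) /
          ∏ j ∈ Finset.range m, Complex.Gamma (1 + h 0 - h (j + 1) + s)) =
      fun s : ℂ => (h 0 + 2 * s) * (∏ j ∈ Finset.range (m + 1), Complex.Gamma (h j + s)) * Complex.Gamma (-s) *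
          ∏ j ∈ Finset.range m, (Complex.Gamma (1 + h 0 - h (j + 1) + s))⁻¹ := by
    funext s; rw [div_eq_mul_inv, Finset.prod_inv_distrib]
  rw [hrew]
  refine DifferentiableAt.mul (DifferentiableAt.mul (DifferentiableAt.mul (by fun_prop) ?_) ?_) ?_
  · refine DifferentiableAt.fun_finsetProd (f := fun j s => Complex.Gamma (h j + s)) fun j hj => ?_
    refine (Complex.differentiableAt_Gamma _ fun n => ne_neg_nat_of_re_pos ?_ n).comp z
      ((differentiableAt_const _).add differentiableAt_id)
    have := hnum j (by simpa [Nat.lt_succ_iff] using hj); simp; linarith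
  · refine (Complex.differentiableAt_Gamma _ fun n hn => hz n ?_).comp z differentiableAt_id.neg
    simpa using congrArg Neg.neg hn
  · refine DifferentiableAt.fun_finsetProd (f := fun j s => (Complex.Gamma (1 + h 0 - h (j + 1) + s))⁻¹) fun j hj => ?_
    exact (Complex.differentiable_one_div_Gamma.differentiableAt).comp z
      ((differentiableAt_const _).add differentiableAt_id)

end Summit.KontsevichZagierPeriods.Zeta5Search.VWPBarnesKernelUniform

end
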